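import Literature.NumberTheory.Sieve.HeathBrownCubicLemma38Holds
import Literature.NumberTheory.Sieve.HeathBrownCubicPrimesFrontier
import Literature.NumberTheory.Sieve.HeathBrownCubicLemma35Holds
import Literature.NumberTheory.Sieve.HeathBrownCubicLeadingA
import Literature.NumberTheory.Sieve.HeathBrownCubicTypeIIFinal
import HarnessLib

/-!
# Heath-Brown's theorem on primes `x³ + 2y³`: the discharge of `HeathBrown2001_primePairCount_asymptotic`

D. R. Heath-Brown, *Primes represented by `x³ + 2y³`*, Acta Math. 186 (2001), 1–84, Theorem (p. 2) in the
quantitative form (2.2) (p. 4): for some `c > 0` and `η = (log X)^{−c}`,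
`π(𝒜) = σ₀ η²X²/(3 log X) · {1 + O((log log X)^{−1/6})}`, `𝒜 = {x³ + 2y³ : x, y ∈ (X, X(1+η]], (x, y) = 1}`
(the named fact `HeathBrown2001_primePairCount_asymptotic` of `HeathBrownCubicPrimes`). Pure-proof file
(one theorem): the last link of the tree's formalisation of the whole paper —
**`HeathBrown2001_primePairCount_asymptotic_holds`**, by `HeathBrown2001_primePairCount_asymptotic_of_typeII`
(`HeathBrownCubicPrimesFrontier`: (2.2) ⇐ (2.3) the prime ideal theorem for first-degree primes + (2.4) the sieve
comparison ⇐ Lemmas 3.4–3.10, §§3–7 of the paper) fed with the four discharged inputs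
`HeathBrown2001_lemma_3_5_holds` (§6, `HeathBrownCubicLemma35Holds`), `HeathBrown2001_lemma_3_8_holds` (§§8–9 with
Lemma 9.4 = Mitsui's prime number theorem with Grössencharakteren, `HeathBrownCubicLemma38Holds`, ineffective through
Siegel's theorem), `HeathBrown2001_lemma_3_9_holds` (§10, `HeathBrownCubicLeadingA`) and
`HeathBrown2001_lemma_3_10_holds` (§§11–13, `HeathBrownCubicTypeIIFinal`).

## References

* D. R. Heath-Brown, *Primes represented by `x³ + 2y³`*, Acta Math. 186 (2001), 1–84: Theorem 1 and (2.2),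
  Lemmas 3.5, 3.8, 3.9, 3.10. [cite: HeathBrownActa2001, Theorem 1 and (2.2)]
* T. Mitsui, *Generalized prime number theorem*, Jap. J. Math. 26 (1956), 1–42. [cite: Mitsui1956, Lemma 5]

## Mathlib / tree search

Tree: `HeathBrown2001_primePairCount_asymptotic_of_typeII` (`HeathBrownCubicPrimesFrontier`),
`HeathBrown2001_lemma_3_5_holds`, `HeathBrown2001_lemma_3_8_holds` (`HeathBrownCubicLemma38Holds`),
`HeathBrown2001_lemma_3_9_holds`, `HeathBrown2001_lemma_3_10_holds`.
`lean search 'primePairCount_asymptotic_holds' --decl`: nothing before this file.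
-/

namespace Literature.NumberTheory.Sieve.CubicPrimes

/-- **Heath-Brown (2001), Theorem 1 in the form (2.2)** — discharge of the named fact
`HeathBrown2001_primePairCount_asymptotic`: there is `c > 0` such that, with `η = (log X)^{−c}`,
`π(𝒜) = σ₀ η²X²/(3 log X){1 + O((log log X)^{−1/6})}` as `X → ∞`; in particular there are infinitely many
primes of the form `x³ + 2y³`. [cite: HeathBrownActa2001, Theorem 1 and (2.2)] -/
theorem HeathBrown2001_primePairCount_asymptotic_holds : HeathBrown2001_primePairCount_asymptotic :=
  HeathBrown2001_primePairCount_asymptotic_of_typeII CubicSieve.HeathBrown2001_lemma_3_5_holds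
    CubicSieve.HeathBrown2001_lemma_3_8_holds CubicSieve.HeathBrown2001_lemma_3_9_holds
    CubicSieve.HeathBrown2001_lemma_3_10_holds

end Literature.NumberTheory.Sieve.CubicPrimes
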